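import Mathlib
import Summits.CriticalPhenomena.Ising3DConformalLimit.Theses.GaussianScaleMixture
import Summits.CriticalPhenomena.Ising3DConformalLimit.Theorems.GSMRigidity.Negative.ThreeAtomKernel
import Literature.MathematicalPhysics.QuantumFieldTheory.MirrorRPKernel

/-!
# `GSMRigidity` (item stmt-CriticalPhenomena-8366): two-row swap reflection positivity — the entry lemma of the position-space line, and a two-row certificate against the three-atom witness

Negative-lane tools for the crux
`Summit.CriticalPhenomena.Ising3DConformalLimit.Theses.GaussianScaleMixture.GSMRigidity`
(crux-triage panel r1, triager 3; supports the line `tilted-lightcone-jump-positivity`).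

* `twoRow_expConvex` — the TWO-ROW reduction of swap reflection positivity: for a kernel `K` that is
  even, invariant under the swap mirror `x₁ = x₂` (normal `nSwap = e₀ - e₁`) and swap-RP in the
  finite-point form of the crux (`IsMirrorRPKernel nSwap K`), the `2m`-point configuration
  row 1 = `t_a (1,-1,0)`, row 2 = `t_a (1,-1,0) + ξ (1,1,0)` (`t_a > 0`) with coefficients
  `(c, ε c)`, `ε = ±1`, gives
  `0 ≤ Σ_a Σ_b c_a c_b [K((t_a+t_b)(1,-1,0)) + ε K((t_a+t_b)(1,-1,0) + ξ (1,1,0))]`,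
  i.e. `k₀ ± G` are positive-definite kernels of `t_a + t_b` on `(0,∞)` (exponentially convex once
  continuous; Bernstein's theorem then continues `G(t) = K(t n + ξ m)` holomorphically to `Re t > 0`).
* `threeAtomKernel_section`, `threeAtomKernel_section_denominator_root`,
  `threeAtomKernel_section_root_normSq`, `threeAtomKernel_section_root_re` — the swap-plane section
  of the witness `threeAtomKernel` (`ThreeAtomKernel.lean`) at offset `ξ = 1` is the rational function
  `G(T) = 1/(3T²+2T+3) + 1/(3T²-2T+3) + 1/(2T²+2)` whose denominator `3T²-2T+3` vanishes at
  `T₀ = (1 + 2√2 i)/3` with `|T₀|² = 1 = ξ²` and `Re T₀ = 1/3 > 0`: a pole on the circle `|T| = |ξ|`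
  in the open right half-plane, so `G` is not holomorphic there.
* `threeAtomKernel_not_twoRow_posdef`, `not_twoRow_expConvex_threeAtomKernel` — accordingly two
  rows already refute swap-RP of the witness: nine two-row times `t_a = (5+a)/16`, `ξ = 1`, `ε = -1`
  and an explicit integer coefficient vector make the two-row form negative (`≈ -9.76`; exact,
  `norm_num`) — with `twoRow_expConvex` a second, independent route to `threeAtomKernel_not_swapRP`.
  The violation is `~10⁻¹⁶` relative to the entries (the pole sits at `70.5°`, near the boundary `90°`
  of the half-plane) — the finite shadow of the exponential law recorded in the crux work file (F10).

No definitions at all (the certificate data live inside the proof).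
-/

noncomputable section

open scoped BigOperators InnerProductSpace
open Literature.MathematicalPhysics.QuantumFieldTheory

namespace Summit.CriticalPhenomena.Ising3DConformalLimit.Theorems.GSMRigidity.Negative

/-- Negation of a planar point. [folklore] -/
theorem neg_mk_eq (a b : ℝ) : -mk a b = mk (-a) (-b) := by
  ext l
  fin_cases l <;> simp [mk]

/-- row1–row1 difference [folklore] -/
theorem twoRow_pt11 (s r : ℝ) :
    mk s (-s) - (ℝ ∙ nSwap)ᗮ.reflection (mk r (-r)) = mk (s + r) (-(s + r)) := by
  rw [reflection_nSwap_mk, mk_sub_mk]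
  congr 1 <;> ring

/-- row1–row2 difference [folklore] -/
theorem twoRow_pt12 (s r ξ : ℝ) :
    mk s (-s) - (ℝ ∙ nSwap)ᗮ.reflection (mk (r + ξ) (ξ - r)) = mk ((s + r) - ξ) (-(s + r) - ξ) := by
  rw [reflection_nSwap_mk, mk_sub_mk]
  congr 1 <;> ring

/-- row2–row1 difference [folklore] -/
theorem twoRow_pt21 (s r ξ : ℝ) :
    mk (s + ξ) (ξ - s) - (ℝ ∙ nSwap)ᗮ.reflection (mk r (-r)) = mk ((s + r) + ξ) (ξ - (s + r)) := by
  rw [reflection_nSwap_mk, mk_sub_mk]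
  congr 1 <;> ring

/-- row2–row2 difference [folklore] -/
theorem twoRow_pt22 (s r ξ : ℝ) :
    mk (s + ξ) (ξ - s) - (ℝ ∙ nSwap)ᗮ.reflection (mk (r + ξ) (ξ - r)) = mk (s + r) (-(s + r)) := by
  rw [reflection_nSwap_mk, mk_sub_mk]
  congr 1 <;> ring

/-- evenness + swap invariance symmetrise the cross block: `K(t n - ξ m) = K(t n + ξ m)`. [folklore] -/
theorem twoRow_cross_symm {K : E3 → ℝ} (heven : ∀ x, K (-x) = K x)
    (hswap : ∀ x, K ((ℝ ∙ nSwap)ᗮ.reflection x) = K x) (s ξ : ℝ) :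
    K (mk (s - ξ) (-s - ξ)) = K (mk (s + ξ) (ξ - s)) := by
  have h1 : mk (s - ξ) (-s - ξ) = -((ℝ ∙ nSwap)ᗮ.reflection (mk (s + ξ) (ξ - s))) := by
    rw [reflection_nSwap_mk, neg_mk_eq]
    congr 1 <;> ring
  rw [h1, heven, hswap]

/-- **Card `tilted-lightcone-jump-positivity`, First lemma (`twoRow_expConvex`), coordinate form.**
For `K` even, swap-invariant and swap-RP (finite-point form of the crux), every `ξ`, `ε = ±1`,
positive times `t_a` and coefficients `c_a`:
`0 ≤ Σ_a Σ_b c_a c_b [K((t_a+t_b)(1,-1,0)) + ε K((t_a+t_b)(1,-1,0) + ξ(1,1,0))]`. [folklore] -/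
theorem twoRow_expConvex {K : E3 → ℝ} (hK : IsMirrorRPKernel nSwap K)
    (heven : ∀ x, K (-x) = K x) (hswap : ∀ x, K ((ℝ ∙ nSwap)ᗮ.reflection x) = K x)
    (ξ ε : ℝ) (hε : ε = 1 ∨ ε = -1) (m : ℕ) (t : Fin m → ℝ) (ht : ∀ a, 0 < t a) (c : Fin m → ℝ) :
    0 ≤ ∑ a, ∑ b, c a * c b *
      (K (mk (t a + t b) (-(t a + t b))) + ε * K (mk ((t a + t b) + ξ) (ξ - (t a + t b)))) := by
  have hpos : ∀ i : Fin m ⊕ Fin m,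
      0 < ⟪Sum.elim (fun a => mk (t a) (-t a)) (fun a => mk (t a + ξ) (ξ - t a)) i, nSwap⟫_ℝ := by
    rintro (a | a)
    · simp only [Sum.elim_inl, inner_mk_nSwap]
      linarith [ht a]
    · simp only [Sum.elim_inr, inner_mk_nSwap]
      linarith [ht a]
  have key := hK.sum_nonneg (Sum.elim (fun a => mk (t a) (-t a)) (fun a => mk (t a + ξ) (ξ - t a)))
    (Sum.elim c (fun a => ε * c a)) hpos
  rw [Fintype.sum_sum_type] at key
  simp only [Fintype.sum_sum_type, Sum.elim_inl, Sum.elim_inr, twoRow_pt11, twoRow_pt12, twoRow_pt21, twoRow_pt22,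
    twoRow_cross_symm heven hswap] at key
  simp only [← Finset.sum_add_distrib] at key
  have key2 := mul_nonneg (show (0:ℝ) ≤ 1 / 2 by norm_num) key
  rw [Finset.mul_sum] at key2
  refine le_of_le_of_eq key2 (Finset.sum_congr rfl fun a _ => ?_)
  rw [Finset.mul_sum]
  refine Finset.sum_congr rfl fun b _ => ?_
  rcases hε with rfl | rfl <;> ring

/-! ### The witness: its swap-plane section is rational with a pole on the magic circle -/

/-- The swap-plane section of the three-atom kernel at offset `ξ = 1` is the rational function
`1/(3T²+2T+3) + 1/(3T²-2T+3) + 1/(2T²+2)`. [folklore] -/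
theorem threeAtomKernel_section (T : ℝ) :
    threeAtomKernel (mk (T + 1) (1 - T)) =
      1 / (3 * T ^ 2 + 2 * T + 3) + 1 / (3 * T ^ 2 - 2 * T + 3) + 1 / (2 * T ^ 2 + 2) := by
  have h1 : 2 * (T + 1) ^ 2 + (1 - T) ^ 2 = 3 * T ^ 2 + 2 * T + 3 := by ring
  have h2 : (T + 1) ^ 2 + 2 * (1 - T) ^ 2 = 3 * T ^ 2 - 2 * T + 3 := by ring
  have h3 : (T + 1) ^ 2 + (1 - T) ^ 2 = 2 * T ^ 2 + 2 := by ring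
  rw [threeAtomKernel_mk, h1, h2, h3]

/-- `T₀ = (1 + 2√2 i)/3` is a root of the section's denominator `3T² - 2T + 3` … [folklore] -/
theorem threeAtomKernel_section_denominator_root :
    (3 : ℂ) * (((1 : ℂ) + 2 * (Real.sqrt 2 : ℂ) * Complex.I) / 3) ^ 2
      - 2 * (((1 : ℂ) + 2 * (Real.sqrt 2 : ℂ) * Complex.I) / 3) + 3 = 0 := by
  have h2 : (Real.sqrt 2 : ℝ) * Real.sqrt 2 = 2 := Real.mul_self_sqrt (by norm_num)
  apply Complex.ext
  · simp [pow_two, Complex.mul_re, Complex.mul_im]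
    nlinarith [h2]
  · simp [pow_two, Complex.mul_re, Complex.mul_im]
    nlinarith [h2]

/-- … it lies on the unit circle `|T₀|² = 1` (the circle `|T| = |ξ|`, `ξ = 1`) … [folklore] -/
theorem threeAtomKernel_section_root_normSq :
    Complex.normSq (((1 : ℂ) + 2 * (Real.sqrt 2 : ℂ) * Complex.I) / 3) = 1 := by
  have h2 : (Real.sqrt 2 : ℝ) * Real.sqrt 2 = 2 := Real.mul_self_sqrt (by norm_num)
  rw [Complex.normSq_apply]
  simp [Complex.mul_re, Complex.mul_im]
  nlinarith [h2]

/-- … and in the open right half-plane `Re T₀ = 1/3 > 0`. [folklore] -/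
theorem threeAtomKernel_section_root_re :
    (((1 : ℂ) + 2 * (Real.sqrt 2 : ℂ) * Complex.I) / 3).re = 1 / 3 := by
  simp [Complex.mul_re, Complex.mul_im]


/-! ### Exact two-row certificate for the witness (found by exact-rational LDLᵀ, `num/tworow_exact.py`)

Nine two-row times `t_a = (5+a)/16`, `a = 0,…,8`, offset `ξ = 1`, sign `ε = -1`, integer coefficients
(8 significant digits suffice): the two-row RP form of `threeAtomKernel` is NEGATIVE (`≈ -9.76`), so the
two-row dictionary of card `tilted-lightcone-jump-positivity` alone refutes swap-RP of the witness
(independently of the 4-row, one-time certificate `threeAtomKernel_not_swapRP`). The violation is tiny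
relative to the entries (`~10⁻¹⁶ ‖c‖² max K`) — the finite shadow of a pole at angle `70.5°` on the magic
circle, close to the boundary `90°`; this is why double-precision Hankel tests cannot resolve near-centre
anisotropies while the analytic jump identity can. -/

/-- **Two rows already fail for the witness: `k₀ - G` is not a positive-definite kernel of
`t_a + t_b` on `(0,∞)`** (`k₀(T) = K(T,-T,0)`, `G(T) = K(T+1,1-T,0)`, `K = threeAtomKernel`).
Certificate (found by exact-rational `LDLᵀ`): nine times `t_a = (5+a)/16`, `a = 0,…,8`, integer
coefficients `(84323, -1373228, 9219421, -33679483, 73813251, -10⁸, 82179622, -37599010, 7355240)`;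
the form equals `≈ -9.76 < 0` (exact, `norm_num`). Composed with `twoRow_expConvex` (ξ = 1, ε = -1)
this re-proves `threeAtomKernel_not_swapRP` from a two-row configuration. [folklore] -/
theorem threeAtomKernel_not_twoRow_posdef :
    ¬ ∀ (m : ℕ) (t : Fin m → ℝ) (c : Fin m → ℝ), (∀ a, 0 < t a) →
      0 ≤ ∑ a, ∑ b, c a * c b *
        (threeAtomKernel (mk (t a + t b) (-(t a + t b))) +
          (-1) * threeAtomKernel (mk ((t a + t b) + 1) (1 - (t a + t b)))) := by
  intro h
  have key := h 9 ![5/16, 3/8, 7/16, 1/2, 9/16, 5/8, 11/16, 3/4, 13/16]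
    ![84323, -1373228, 9219421, -33679483, 73813251, -100000000, 82179622, -37599010, 7355240]
    (by intro a; fin_cases a <;> norm_num)
  simp only [Fin.sum_univ_succ, Fin.sum_univ_zero, Matrix.cons_val_zero, Matrix.cons_val_succ,
    threeAtomKernel_mk] at key
  norm_num at key

/-- The three-atom kernel is even. [folklore] -/
theorem threeAtomKernel_even (x : E3) : threeAtomKernel (-x) = threeAtomKernel x := by
  simp [threeAtomKernel]

/-- **Two rows suffice**: swap reflection positivity of an even, swap-invariant kernel already
fails for `threeAtomKernel` on a two-row configuration (a second, independent route to
`threeAtomKernel_not_swapRP`, stated here as the failure of the two-row conclusion of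
`twoRow_expConvex`). [folklore] -/
theorem not_twoRow_expConvex_threeAtomKernel :
    ¬ ∀ (ξ ε : ℝ), (ε = 1 ∨ ε = -1) → ∀ (m : ℕ) (t : Fin m → ℝ), (∀ a, 0 < t a) →
      ∀ c : Fin m → ℝ, 0 ≤ ∑ a, ∑ b, c a * c b *
        (threeAtomKernel (mk (t a + t b) (-(t a + t b))) +
          ε * threeAtomKernel (mk ((t a + t b) + ξ) (ξ - (t a + t b)))) := by
  intro h
  exact threeAtomKernel_not_twoRow_posdef fun m t c ht => h 1 (-1) (Or.inr rfl) m t ht c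

end Summit.CriticalPhenomena.Ising3DConformalLimit.Theorems.GSMRigidity.Negative
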